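import Summits.BirchSwinnertonDyer.BirchSwinnertonDyer.Theorems.ResidualThetaTransportAtTwoResidualSignedLambdaLowerCMAtTwoEntryOfFinrank
import Summits.BirchSwinnertonDyer.BirchSwinnertonDyer.Theorems.ResidualThetaTransportAtTwoResidualSignedLambdaLowerCMAtTwoFourTermDuality
import Summits.BirchSwinnertonDyer.BirchSwinnertonDyer.Theses.ResidualThetaTransportAtTwo
import HarnessLib

/-!
# Stub-critic g9 sketch (STUB-PLAN rev 9 §3): the ONE-PAIR `_of` for stmt-BirchSwinnertonDyer-22608 —
# `cmLambdaLower_of_dualityData_onePair` (RSL_g ⟸ one imprimitive duality datum on THE Selmer module `Sg` itself)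

Critic seat `planner-scrit-stub_cmLambdaLower-g9` (crux dir of stmt-BirchSwinnertonDyer-26074; the stub `stub_cmLambdaLower` of
`Lines/bt26_lambda.lean` IS the route crux RSL_g = stmt-BirchSwinnertonDyer-22608 by name). THEOREMS ONLY, no `sorry`, closes nothing:
RSL_g is NOT proved (the one-pair duality datum is the hypothesis); BSD is not proved by any of this.

WHAT. The lead's landed two-pair composition `LambdaLowerBoundO.cmLambdaLower_of_dualityData` (p669433) routes `Σ_g(S₀)` through a
SECOND object `PS` (`res : Sg → PS`, `Σ ≤ λ(PS⋆)`, torsion cokernel) and the Kobayashi four-term datum through `ker res`. The one-pair road of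
STUB-PLAN rev 8 §3 (recommended TOP) puts the imprimitive local conditions INSIDE the single datum: the pairing is valued in `Sg⋆`
(`pair : P → CharacterModule Sg`, `P = P⁺_2 ⊕ ⨁_{w ∈ S₀,∞} H¹(ℚ_{∞,w}, T_g)`-shaped), the strict submodule `Sel₀ ≤ Sg`, and the deep-half
inequality carries the local ranks: `d + Σ_g(S₀) + e ≤ λ(P / locd Z)`. Then RSL_g follows from the entry point
`cmLambdaLower_of_finrank_characterModule` (p666435) and `CharIdealLambda.le_finrank_baseChange_characterModule_of_duality_decorated` (p664041)
ALONE — no `res`, no `PS`, no `ImprimitiveDuality`, no second Poitou–Tate instance for `coker res`.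

* `cmLambdaLower_of_dualityData_onePair` — conclusion = text of RSL_g VERBATIM.
* `residualSignedLambdaLowerCMAtTwo_of_onePairData` — the same, concluding the route decl BY NAME (what a registered `Lines/<slug>.lean`
  `_of` must do; a one-stub skeleton whose stub is this hypothesis would be INTERIM only — see STUB-PLAN rev 9 §3 for the 4–5-stub cut).

References: [Kobayashi2003] Thm. 7.3 ((7.21), p. 13); [BurungaleTian2026] Thm. 2.6; [GreenbergVatsal2000] §2; [PerrinRiou2000SMF] App. A.3.
-/

set_option autoImplicit false
set_option linter.dupNamespace false
-- the 3900-character binder blocks of the registered RSL_g signature need more than the default budget to elaborate (as in p666435 / p669433)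
set_option maxHeartbeats 800000

noncomputable section

open scoped Classical TensorProduct

namespace Summit.BirchSwinnertonDyer.BirchSwinnertonDyer.Cruxes.ResidualThetaCountLowerPureAtTwo.ScritG9

open Summit.BirchSwinnertonDyer.BirchSwinnertonDyer.Theorems
open Summit.BirchSwinnertonDyer.BirchSwinnertonDyer.Theorems.LambdaLowerBoundO
open Literature.NumberTheory.EllipticCurves Literature.NumberTheory.EllipticCurves.GreenbergSelmer
open Literature.NumberTheory.GaloisRepresentations NumberField IsDedekindDomain Field
open Literature.NumberTheory.EllipticCurves GreenbergSelmer GreenbergVatsal2000 Kobayashi2003 ModularForms Rank1Residual Literature.NumberTheory.GaloisRepresentations Literature.NumberTheory.Automorphic IsDedekindDomain NumberField Field Rat.HeightOneSpectrum PowerSeries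

/-- **RSL_g ⟸ ONE imprimitive duality datum on THE Selmer module** (STUB-PLAN rev 8/9 §3, the one-pair road): for every datum of RSL_g and
THE Selmer module `Sg` (scalars `scalarH1`, membership iff the three clauses, `conj`-stable, finite branch) there are `P, H, H2`,
`pair : P → Sg⋆`, `locd : H → P`, `Z ≤ H`, `Sel₀ ≤ Sg`, `e` with (EH_Z), (ORTH), (DH up to torsion), `K ⊗ H/Z` and `K ⊗ P/locd Z` finite,
`d + Σ_g(S₀) + e ≤ λ(P/locd Z)`, `λ(H/Z) ≤ λ(H2) + e`, `λ(H2) ≤ λ(Sel₀⋆)`. Conclusion: the text of RSL_g VERBATIM.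
[cite: Kobayashi2003, Thm. 7.3 ((7.21), p. 13)] [cite: BurungaleTian2026, Thm. 2.6 (p. 5)] [cite: GreenbergVatsal2000, §2 (Cor. 2.3)] -/
theorem cmLambdaLower_of_dualityData_onePair
    (hdata :
    open Literature.NumberTheory.EllipticCurves GreenbergSelmer GreenbergVatsal2000 Kobayashi2003 ModularForms Rank1Residual Literature.NumberTheory.GaloisRepresentations Literature.NumberTheory.Automorphic IsDedekindDomain NumberField Field Rat.HeightOneSpectrum PowerSeries in ∀ (W : WeierstrassCurve ℚ) [W.IsElliptic] [W.IsGloballyMinimal], ¬ W.HasCM → W.analyticRank = 0 → GoodSS W 2 → W.frobeniusTrace 2 = 0 → W.Δ < 0 → ∀ (M : ℕ) [NeZero M] (g : CuspForm (CongruenceSubgroup.Gamma0 M) 2) (ι : coeffField g →+* PadicAlgCl 2) (Ω : ℂ), Odd M → IsNewform0 g → IsCMForm (liftToGamma1 M 2 g) → cuspCoeff g 2 = 0 → IsCohomologicalPlusPeriod g ι Ω → (∀ ℓ : ℕ, ℓ.Prime → ¬ ℓ ∣ 2 * M * W.conductorNorm ℤ → ‖embCoeff g ι ℓ - (W.frobeniusTrace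 ℓ : PadicAlgCl 2)‖ < 1) → ∀ (κ : ZpExtension ℚ 2) (γ : absoluteGaloisGroup ℚ), κ.IsCyclotomic → κ.IsTopGenerator γ → IsCyclotomicVariable 2 γ → ∀ (S₀ : Finset (HeightOneSpectrum (RingOfIntegers ℚ))), (∀ v ∈ S₀, ((2 : ℕ) : RingOfIntegers ℚ) ∉ v.asIdeal) → (∀ v, ¬ W.HasGoodReductionAt v → v ∈ S₀) → (∀ v, natGenerator v ∣ M → v ∈ S₀) → ∀ (Lp Lm : IwasawaAlgebraO (Set.range ι)) (d : ℕ), IsPollackPairK g ι Ω Lp Lm → (∀ k, ‖coeff k (iwasawaOToPowerSeries (Set.range ι) Lm)‖ ≤ ‖coeff d (iwasawaOToPowerSeries (Set.range ι) Lm)‖) → (∀ k < d, ‖coeff k (iwasawaOToPowerSeries (Set.range ι) Lm)‖ < ‖coeff d (iwasawaOToPowerSeries (Set.range ι) Lm)‖) → ∀ (n : ℕ) (ρ : FramedGaloisRep ℚ ↥(padicCoeffIntegers (Set.range ι)) 2) (Θ : ∀ v : HeightOneSpectrum (RingOfIntegers ℚ), ((2 : ℕ) : RingOfIntegers ℚ)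 ∈ v.asIdeal → (Cofree ρ ↥(padicCoeffField (Set.range ι)) ≃+ (Fin n → ↥(W.geomPrimaryTorsion 2)))), (∀ v, ¬ natGenerator v ∣ 2 * M → ρ.IsUnramifiedAt v ∧ ∃ P : Polynomial ↥(padicCoeffIntegers (Set.range ι)), P.map (padicCoeffIntegers (Set.range ι)).subtype = Polynomial.X ^ 2 - Polynomial.C (embCoeff g ι (natGenerator v)) * Polynomial.X + Polynomial.C ((natGenerator v : ℕ) : PadicAlgCl 2) ∧ ρ.HasFrobCharpolyAt v P) → (∀ v hv (δ : absoluteGaloisGroup (v.adicCompletion ℚ)) m i, Θ v hv (resGalOfEmb (closureEmb (K := ℚ) (v.adicCompletion ℚ)) δ • m) i = resGalOfEmb (closureEmb (K := ℚ) (v.adicCompletion ℚ)) δ • Θ v hv m i) → ∀ (ϖ : ↥(padicCoeffIntegers (Set.range ι))), Irreducible ϖ → ∀ (Sg : AddSubgroup (subgroupH1 κ.kerSubgroup (Cofree ρ ↥(padicCoeffField (Set.range ι))))) [Module ↥(padicCoeffIntegers (Set.range ι)) ↥Sg], (∀ (a : ↥(padicCoeffIntegers (Set.range ι))) (s : ↥Sg),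 ((a • s : ↥Sg) : subgroupH1 κ.kerSubgroup (Cofree ρ ↥(padicCoeffField (Set.range ι)))) = scalarH1 κ.kerSubgroup (Cofree ρ ↥(padicCoeffField (Set.range ι))) a s) → (∀ y : subgroupH1 κ.kerSubgroup (Cofree ρ ↥(padicCoeffField (Set.range ι))), y ∈ Sg ↔ y ∈ {y : subgroupH1 κ.kerSubgroup (Cofree ρ ↥(padicCoeffField (Set.range ι))) | y ∈ unramifiedOutside κ.kerSubgroup (Cofree ρ ↥(padicCoeffField (Set.range ι))) 2 ↑S₀ ∧ (∀ w σ, conjH1 κ.kerSubgroup (Cofree ρ ↥(padicCoeffField (Set.range ι))) σ y ∈ infKer κ.kerSubgroup (Cofree ρ ↥(padicCoeffField (Set.range ι))) w) ∧ (∀ v hv σ, ∃ (φ : _) (Q : Fin n → localPoints W (v.adicCompletion ℚ)) (k : ℕ), oneCocycleClass (discreteTopRep ↥κ.kerSubgroup (Cofree ρ ↥(padicCoeffField (Set.range ι)))) φ = conjH1 κ.kerSubgroup (Cofree ρ ↥(padicCoeffField (Set.range ι))) σ y ∧ (∀ i, (2 ^ k) • Q i ∈ ⨆ m : ℕ, signedLocalPoints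 κ (v.adicCompletion ℚ) W 1 m) ∧ ∀ τ i, pointsMapOfEmb W (closureEmb (K := ℚ) (v.adicCompletion ℚ)) (((Θ v hv (φ.1 (resGalSubgroupOfEmb κ.kerSubgroup (closureEmb (K := ℚ) (v.adicCompletion ℚ)) τ))) i : ↥(W.geomPrimaryTorsion 2)) : W.geomPoints) = (τ : absoluteGaloisGroup (v.adicCompletion ℚ)) • Q i - Q i)}) → (∀ (τ : absoluteGaloisGroup ℚ) (y : subgroupH1 κ.kerSubgroup (Cofree ρ ↥(padicCoeffField (Set.range ι)))), y ∈ Sg → conjH1 κ.kerSubgroup (Cofree ρ ↥(padicCoeffField (Set.range ι))) τ y ∈ Sg) → ({y : subgroupH1 κ.kerSubgroup (Cofree ρ ↥(padicCoeffField (Set.range ι))) | y ∈ unramifiedOutside κ.kerSubgroup (Cofree ρ ↥(padicCoeffField (Set.range ι))) 2 ↑S₀ ∧ (∀ w σ, conjH1 κ.kerSubgroup (Cofree ρ ↥(padicCoeffField (Set.range ι))) σ y ∈ infKer κ.kerSubgroup (Cofree ρ ↥(padicCoeffField (Set.range ι))) w) ∧ (∀ v hv σ, ∃ (φ : _) (Q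 : Fin n → localPoints W (v.adicCompletion ℚ)) (k : ℕ), oneCocycleClass (discreteTopRep ↥κ.kerSubgroup (Cofree ρ ↥(padicCoeffField (Set.range ι)))) φ = conjH1 κ.kerSubgroup (Cofree ρ ↥(padicCoeffField (Set.range ι))) σ y ∧ (∀ i, (2 ^ k) • Q i ∈ ⨆ m : ℕ, signedLocalPoints κ (v.adicCompletion ℚ) W 1 m) ∧ ∀ τ i, pointsMapOfEmb W (closureEmb (K := ℚ) (v.adicCompletion ℚ)) (((Θ v hv (φ.1 (resGalSubgroupOfEmb κ.kerSubgroup (closureEmb (K := ℚ) (v.adicCompletion ℚ)) τ))) i : ↥(W.geomPrimaryTorsion 2)) : W.geomPoints) = (τ : absoluteGaloisGroup (v.adicCompletion ℚ)) • Q i - Q i) ∧ scalarH1 κ.kerSubgroup (Cofree ρ ↥(padicCoeffField (Set.range ι))) ϖ y = 0} : Set _).Finite → ∃ (P : Type) (_ : AddCommGroup P) (_ : Module ↥(padicCoeffIntegers (Set.range ι)) P) (H : Type) (_ : AddCommGroup H) (_ : Module ↥(padicCoeffIntegers (Set.range ι)) H) (H2 : Type) (_ : AddCommGroup H2) (_ :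 Module ↥(padicCoeffIntegers (Set.range ι)) H2) (pair : P →ₗ[↥(padicCoeffIntegers (Set.range ι))] CharacterModule ↥Sg) (locd : H →ₗ[↥(padicCoeffIntegers (Set.range ι))] P) (Z : Submodule ↥(padicCoeffIntegers (Set.range ι)) H) (Sel₀ : Submodule ↥(padicCoeffIntegers (Set.range ι)) ↥Sg) (e : ℕ), (∀ z ∈ Z, pair (locd z) = 0) ∧ (∀ s ∈ Sel₀, ∀ z : P, pair z s = 0) ∧ (∀ z : P, pair z = 0 → ∃ a : ↥(padicCoeffIntegers (Set.range ι)), a ≠ 0 ∧ ∃ x : H, a • z = locd x) ∧ Module.Finite (FractionRing ↥(padicCoeffIntegers (Set.range ι))) (TensorProduct ↥(padicCoeffIntegers (Set.range ι)) (FractionRing ↥(padicCoeffIntegers (Set.range ι))) (H ⧸ Z)) ∧ Module.Finite (FractionRing ↥(padicCoeffIntegers (Set.range ι))) (TensorProduct ↥(padicCoeffIntegers (Set.range ι)) (FractionRing ↥(padicCoeffIntegers (Set.range ι))) (P ⧸ Z.map locd)) ∧ d + (∑ v ∈ S₀, 2 ^ padicValNat 2 ((natGenerator v ^ 2 - 1)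 / 8) * (if natGenerator v ∣ M then (if ‖embCoeff g ι (natGenerator v) - 1‖ < 1 then 1 else 0) else (if ‖embCoeff g ι (natGenerator v)‖ < 1 then 2 else 0))) + e ≤ Module.finrank (FractionRing ↥(padicCoeffIntegers (Set.range ι))) (TensorProduct ↥(padicCoeffIntegers (Set.range ι)) (FractionRing ↥(padicCoeffIntegers (Set.range ι))) (P ⧸ Z.map locd)) ∧ Module.finrank (FractionRing ↥(padicCoeffIntegers (Set.range ι))) (TensorProduct ↥(padicCoeffIntegers (Set.range ι)) (FractionRing ↥(padicCoeffIntegers (Set.range ι))) (H ⧸ Z)) ≤ Module.finrank (FractionRing ↥(padicCoeffIntegers (Set.range ι))) (TensorProduct ↥(padicCoeffIntegers (Set.range ι)) (FractionRing ↥(padicCoeffIntegers (Set.range ι))) (H2)) + e ∧ Module.finrank (FractionRing ↥(padicCoeffIntegers (Set.range ι))) (TensorProduct ↥(padicCoeffIntegers (Set.range ι)) (FractionRing ↥(padicCoeffIntegers (Set.range ι))) (H2)) ≤ Module.finrank (FractionRing ↥(padicCoeffIntegers (Set.range ι))) (TensorProduct ↥(padicCoeffIntegers (Set.range ι)) (FractionRing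 ↥(padicCoeffIntegers (Set.range ι))) (CharacterModule ↥Sel₀))) :
    open Literature.NumberTheory.EllipticCurves GreenbergSelmer GreenbergVatsal2000 Kobayashi2003 ModularForms Rank1Residual Literature.NumberTheory.GaloisRepresentations Literature.NumberTheory.Automorphic IsDedekindDomain NumberField Field Rat.HeightOneSpectrum PowerSeries in ∀ (W : WeierstrassCurve ℚ) [W.IsElliptic] [W.IsGloballyMinimal], ¬ W.HasCM → W.analyticRank = 0 → GoodSS W 2 → W.frobeniusTrace 2 = 0 → W.Δ < 0 → ∀ (M : ℕ) [NeZero M] (g : CuspForm (CongruenceSubgroup.Gamma0 M) 2) (ι : coeffField g →+* PadicAlgCl 2) (Ω : ℂ), Odd M → IsNewform0 g → IsCMForm (liftToGamma1 M 2 g) → cuspCoeff g 2 = 0 → IsCohomologicalPlusPeriod g ι Ω → (∀ ℓ : ℕ, ℓ.Prime → ¬ ℓ ∣ 2 * M * W.conductorNorm ℤ → ‖embCoeff g ι ℓ - (W.frobeniusTrace ℓ : PadicAlgCl 2)‖ < 1) → ∀ (κ : ZpExtension ℚ 2) (γ : absoluteGaloisGroup ℚ), κ.IsCyclotomic → κ.IsTopGenerator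 γ → IsCyclotomicVariable 2 γ → ∀ (S₀ : Finset (HeightOneSpectrum (RingOfIntegers ℚ))), (∀ v ∈ S₀, ((2 : ℕ) : RingOfIntegers ℚ) ∉ v.asIdeal) → (∀ v, ¬ W.HasGoodReductionAt v → v ∈ S₀) → (∀ v, natGenerator v ∣ M → v ∈ S₀) → ∀ (Lp Lm : IwasawaAlgebraO (Set.range ι)) (d : ℕ), IsPollackPairK g ι Ω Lp Lm → (∀ k, ‖coeff k (iwasawaOToPowerSeries (Set.range ι) Lm)‖ ≤ ‖coeff d (iwasawaOToPowerSeries (Set.range ι) Lm)‖) → (∀ k < d, ‖coeff k (iwasawaOToPowerSeries (Set.range ι) Lm)‖ < ‖coeff d (iwasawaOToPowerSeries (Set.range ι) Lm)‖) → ∀ (n : ℕ) (ρ : FramedGaloisRep ℚ ↥(padicCoeffIntegers (Set.range ι)) 2) (Θ : ∀ v : HeightOneSpectrum (RingOfIntegers ℚ), ((2 : ℕ) : RingOfIntegers ℚ) ∈ v.asIdeal → (Cofree ρ ↥(padicCoeffField (Set.range ι)) ≃+ (Fin n → ↥(W.geomPrimaryTorsion 2)))), (∀ v, ¬ natGenerator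 v ∣ 2 * M → ρ.IsUnramifiedAt v ∧ ∃ P : Polynomial ↥(padicCoeffIntegers (Set.range ι)), P.map (padicCoeffIntegers (Set.range ι)).subtype = Polynomial.X ^ 2 - Polynomial.C (embCoeff g ι (natGenerator v)) * Polynomial.X + Polynomial.C ((natGenerator v : ℕ) : PadicAlgCl 2) ∧ ρ.HasFrobCharpolyAt v P) → (∀ v hv (δ : absoluteGaloisGroup (v.adicCompletion ℚ)) m i, Θ v hv (resGalOfEmb (closureEmb (K := ℚ) (v.adicCompletion ℚ)) δ • m) i = resGalOfEmb (closureEmb (K := ℚ) (v.adicCompletion ℚ)) δ • Θ v hv m i) → ∀ (ϖ : ↥(padicCoeffIntegers (Set.range ι))), Irreducible ϖ → ((Nat.card (↥(padicCoeffIntegers (Set.range ι)) ⧸ Ideal.span {ϖ}) ^ (d + ∑ v ∈ S₀, 2 ^ padicValNat 2 ((natGenerator v ^ 2 - 1) / 8) * (if natGenerator v ∣ M then (if ‖embCoeff g ι (natGenerator v) - 1‖ < 1 then 1 else 0) else (if ‖embCoeff g ι (natGenerator v)‖ < 1 then 2 else 0))) : ℕ) : ℕ∞) ≤ {y : subgroupH1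 κ.kerSubgroup (Cofree ρ ↥(padicCoeffField (Set.range ι))) | y ∈ unramifiedOutside κ.kerSubgroup (Cofree ρ ↥(padicCoeffField (Set.range ι))) 2 ↑S₀ ∧ (∀ w σ, conjH1 κ.kerSubgroup (Cofree ρ ↥(padicCoeffField (Set.range ι))) σ y ∈ infKer κ.kerSubgroup (Cofree ρ ↥(padicCoeffField (Set.range ι))) w) ∧ (∀ v hv σ, ∃ (φ : _) (Q : Fin n → localPoints W (v.adicCompletion ℚ)) (k : ℕ), oneCocycleClass (discreteTopRep ↥κ.kerSubgroup (Cofree ρ ↥(padicCoeffField (Set.range ι)))) φ = conjH1 κ.kerSubgroup (Cofree ρ ↥(padicCoeffField (Set.range ι))) σ y ∧ (∀ i, (2 ^ k) • Q i ∈ ⨆ m : ℕ, signedLocalPoints κ (v.adicCompletion ℚ) W 1 m) ∧ ∀ τ i, pointsMapOfEmb W (closureEmb (K := ℚ) (v.adicCompletion ℚ)) (((Θ v hv (φ.1 (resGalSubgroupOfEmb κ.kerSubgroup (closureEmb (K := ℚ) (v.adicCompletion ℚ)) τ))) i : ↥(W.geomPrimaryTorsion 2)) : W.geomPoints) = (τ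 : absoluteGaloisGroup (v.adicCompletion ℚ)) • Q i - Q i) ∧ scalarH1 κ.kerSubgroup (Cofree ρ ↥(padicCoeffField (Set.range ι))) ϖ y = 0}.encard := by
  refine cmLambdaLower_of_finrank_characterModule ?_
  intro W _ _ hCM hr0 hss ha2 hΔ M _ g ι Ω hM hnew hcmf ha2g hΩ hcong κ γ hκ hγ hcyc S₀ hS₀ hbad hMS Lp Lm d hpair
    hle hlt n ρ Θ hρ hΘ ϖ hϖ Sg inst hsmul hmem hconj hfin
  haveI : FiniteDimensional ℚ (ModularForms.coeffField g) :=
    ModularForms.IsNewform0.finiteDimensional_coeffField_holds hnew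
  haveI : FiniteDimensional ℚ_[2] ↥(padicCoeffField (Set.range ι)) :=
    GreenbergSelmer.finiteDimensional_padicCoeffField ι
  haveI : IsDiscreteValuationRing ↥(padicCoeffIntegers (Set.range ι)) :=
    PollackPairK.isDiscreteValuationRing_padicCoeffIntegers
  -- «μ = 0 for free»: `Sg⋆` is finitely generated over `𝒪`, hence `K ⊗ Sg⋆` is finite-dimensional (p665052)
  have hfin' : {c : subgroupH1 κ.kerSubgroup (Cofree ρ ↥(padicCoeffField (Set.range ι))) |
      c ∈ Sg ∧ scalarH1 κ.kerSubgroup (Cofree ρ ↥(padicCoeffField (Set.range ι))) ϖ c = 0}.Finite :=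
    hfin.subset fun y hy ↦
      ⟨((hmem y).1 hy.1).1, ((hmem y).1 hy.1).2.1, ((hmem y).1 hy.1).2.2, hy.2⟩
  haveI : Module.Finite ↥(padicCoeffIntegers (Set.range ι)) (CharacterModule ↥Sg) :=
    module_finite_characterModule_of_finite_scalarH1_torsion (Set.range ι) κ ρ Sg hsmul hϖ hfin'
  haveI : Module.Finite (FractionRing ↥(padicCoeffIntegers (Set.range ι)))
      (TensorProduct ↥(padicCoeffIntegers (Set.range ι)) (FractionRing ↥(padicCoeffIntegers (Set.range ι))) (CharacterModule ↥Sg)) :=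
    inferInstance
  -- the one-pair duality datum (`Exists.elim` chains, no pattern matching against the large goal)
  refine (hdata W hCM hr0 hss ha2 hΔ M g ι Ω hM hnew hcmf ha2g hΩ hcong κ γ hκ hγ hcyc S₀ hS₀ hbad hMS Lp Lm d hpair
    hle hlt n ρ Θ hρ hΘ ϖ hϖ Sg hsmul hmem hconj hfin).elim fun P h5 ↦ ?_
  refine h5.elim fun _ h6 ↦ h6.elim fun _ h7 ↦ h7.elim fun H h8 ↦ h8.elim fun _ h9 ↦ h9.elim fun _ h10 ↦ ?_
  refine h10.elim fun H2 h11 ↦ h11.elim fun _ h12 ↦ h12.elim fun _ h13 ↦ h13.elim fun pair h14 ↦ h14.elim fun locd h15 ↦ ?_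
  refine h15.elim fun Z h16 ↦ h16.elim fun Sel₀ h17 ↦ h17.elim fun e h18 ↦ ?_
  haveI := h18.2.2.2.1
  haveI := h18.2.2.2.2.1
  exact CharIdealLambda.le_finrank_baseChange_characterModule_of_duality_decorated (FractionRing ↥(padicCoeffIntegers (Set.range ι)))
    pair locd Z Sel₀ h18.1 h18.2.1 h18.2.2.1 h18.2.2.2.2.2.1 h18.2.2.2.2.2.2.1 h18.2.2.2.2.2.2.2


/-- The one-pair `_of` concluding the route crux RSL_g (stmt-BirchSwinnertonDyer-22608) BY NAME. -/
theorem residualSignedLambdaLowerCMAtTwo_of_onePairData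
    (hdata :
    open Literature.NumberTheory.EllipticCurves GreenbergSelmer GreenbergVatsal2000 Kobayashi2003 ModularForms Rank1Residual Literature.NumberTheory.GaloisRepresentations Literature.NumberTheory.Automorphic IsDedekindDomain NumberField Field Rat.HeightOneSpectrum PowerSeries in ∀ (W : WeierstrassCurve ℚ) [W.IsElliptic] [W.IsGloballyMinimal], ¬ W.HasCM → W.analyticRank = 0 → GoodSS W 2 → W.frobeniusTrace 2 = 0 → W.Δ < 0 → ∀ (M : ℕ) [NeZero M] (g : CuspForm (CongruenceSubgroup.Gamma0 M) 2) (ι : coeffField g →+* PadicAlgCl 2) (Ω : ℂ), Odd M → IsNewform0 g → IsCMForm (liftToGamma1 M 2 g) → cuspCoeff g 2 = 0 → IsCohomologicalPlusPeriod g ι Ω → (∀ ℓ : ℕ, ℓ.Prime → ¬ ℓ ∣ 2 * M * W.conductorNorm ℤ → ‖embCoeff g ι ℓ - (W.frobeniusTrace ℓ : PadicAlgCl 2)‖ < 1) → ∀ (κ : ZpExtension ℚ 2) (γ : absoluteGaloisGroup ℚ), κ.IsCyclotomic → κ.IsTopGenerator γ → IsCyclotomicVariable 2 γ → ∀ (S₀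 : Finset (HeightOneSpectrum (RingOfIntegers ℚ))), (∀ v ∈ S₀, ((2 : ℕ) : RingOfIntegers ℚ) ∉ v.asIdeal) → (∀ v, ¬ W.HasGoodReductionAt v → v ∈ S₀) → (∀ v, natGenerator v ∣ M → v ∈ S₀) → ∀ (Lp Lm : IwasawaAlgebraO (Set.range ι)) (d : ℕ), IsPollackPairK g ι Ω Lp Lm → (∀ k, ‖coeff k (iwasawaOToPowerSeries (Set.range ι) Lm)‖ ≤ ‖coeff d (iwasawaOToPowerSeries (Set.range ι) Lm)‖) → (∀ k < d, ‖coeff k (iwasawaOToPowerSeries (Set.range ι) Lm)‖ < ‖coeff d (iwasawaOToPowerSeries (Set.range ι) Lm)‖) → ∀ (n : ℕ) (ρ : FramedGaloisRep ℚ ↥(padicCoeffIntegers (Set.range ι)) 2) (Θ : ∀ v : HeightOneSpectrum (RingOfIntegers ℚ), ((2 : ℕ) : RingOfIntegers ℚ) ∈ v.asIdeal → (Cofree ρ ↥(padicCoeffField (Set.range ι)) ≃+ (Fin n → ↥(W.geomPrimaryTorsion 2)))), (∀ v, ¬ natGenerator v ∣ 2 * M → ρ.IsUnramifiedAt v ∧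 ∃ P : Polynomial ↥(padicCoeffIntegers (Set.range ι)), P.map (padicCoeffIntegers (Set.range ι)).subtype = Polynomial.X ^ 2 - Polynomial.C (embCoeff g ι (natGenerator v)) * Polynomial.X + Polynomial.C ((natGenerator v : ℕ) : PadicAlgCl 2) ∧ ρ.HasFrobCharpolyAt v P) → (∀ v hv (δ : absoluteGaloisGroup (v.adicCompletion ℚ)) m i, Θ v hv (resGalOfEmb (closureEmb (K := ℚ) (v.adicCompletion ℚ)) δ • m) i = resGalOfEmb (closureEmb (K := ℚ) (v.adicCompletion ℚ)) δ • Θ v hv m i) → ∀ (ϖ : ↥(padicCoeffIntegers (Set.range ι))), Irreducible ϖ → ∀ (Sg : AddSubgroup (subgroupH1 κ.kerSubgroup (Cofree ρ ↥(padicCoeffField (Set.range ι))))) [Module ↥(padicCoeffIntegers (Set.range ι)) ↥Sg], (∀ (a : ↥(padicCoeffIntegers (Set.range ι))) (s : ↥Sg), ((a • s : ↥Sg) : subgroupH1 κ.kerSubgroup (Cofree ρ ↥(padicCoeffField (Set.range ι)))) = scalarH1 κ.kerSubgroup (Cofree ρ ↥(padicCoeffField (Set.range ι))) a s) → (∀ y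 : subgroupH1 κ.kerSubgroup (Cofree ρ ↥(padicCoeffField (Set.range ι))), y ∈ Sg ↔ y ∈ {y : subgroupH1 κ.kerSubgroup (Cofree ρ ↥(padicCoeffField (Set.range ι))) | y ∈ unramifiedOutside κ.kerSubgroup (Cofree ρ ↥(padicCoeffField (Set.range ι))) 2 ↑S₀ ∧ (∀ w σ, conjH1 κ.kerSubgroup (Cofree ρ ↥(padicCoeffField (Set.range ι))) σ y ∈ infKer κ.kerSubgroup (Cofree ρ ↥(padicCoeffField (Set.range ι))) w) ∧ (∀ v hv σ, ∃ (φ : _) (Q : Fin n → localPoints W (v.adicCompletion ℚ)) (k : ℕ), oneCocycleClass (discreteTopRep ↥κ.kerSubgroup (Cofree ρ ↥(padicCoeffField (Set.range ι)))) φ = conjH1 κ.kerSubgroup (Cofree ρ ↥(padicCoeffField (Set.range ι))) σ y ∧ (∀ i, (2 ^ k) • Q i ∈ ⨆ m : ℕ, signedLocalPoints κ (v.adicCompletion ℚ) W 1 m) ∧ ∀ τ i, pointsMapOfEmb W (closureEmb (K := ℚ) (v.adicCompletion ℚ)) (((Θ v hv (φ.1 (resGalSubgroupOfEmb κ.kerSubgroup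 (closureEmb (K := ℚ) (v.adicCompletion ℚ)) τ))) i : ↥(W.geomPrimaryTorsion 2)) : W.geomPoints) = (τ : absoluteGaloisGroup (v.adicCompletion ℚ)) • Q i - Q i)}) → (∀ (τ : absoluteGaloisGroup ℚ) (y : subgroupH1 κ.kerSubgroup (Cofree ρ ↥(padicCoeffField (Set.range ι)))), y ∈ Sg → conjH1 κ.kerSubgroup (Cofree ρ ↥(padicCoeffField (Set.range ι))) τ y ∈ Sg) → ({y : subgroupH1 κ.kerSubgroup (Cofree ρ ↥(padicCoeffField (Set.range ι))) | y ∈ unramifiedOutside κ.kerSubgroup (Cofree ρ ↥(padicCoeffField (Set.range ι))) 2 ↑S₀ ∧ (∀ w σ, conjH1 κ.kerSubgroup (Cofree ρ ↥(padicCoeffField (Set.range ι))) σ y ∈ infKer κ.kerSubgroup (Cofree ρ ↥(padicCoeffField (Set.range ι))) w) ∧ (∀ v hv σ, ∃ (φ : _) (Q : Fin n → localPoints W (v.adicCompletion ℚ)) (k : ℕ), oneCocycleClass (discreteTopRep ↥κ.kerSubgroup (Cofree ρ ↥(padicCoeffField (Set.range ι)))) φ = conjH1 κ.kerSubgroup (Cofree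 ρ ↥(padicCoeffField (Set.range ι))) σ y ∧ (∀ i, (2 ^ k) • Q i ∈ ⨆ m : ℕ, signedLocalPoints κ (v.adicCompletion ℚ) W 1 m) ∧ ∀ τ i, pointsMapOfEmb W (closureEmb (K := ℚ) (v.adicCompletion ℚ)) (((Θ v hv (φ.1 (resGalSubgroupOfEmb κ.kerSubgroup (closureEmb (K := ℚ) (v.adicCompletion ℚ)) τ))) i : ↥(W.geomPrimaryTorsion 2)) : W.geomPoints) = (τ : absoluteGaloisGroup (v.adicCompletion ℚ)) • Q i - Q i) ∧ scalarH1 κ.kerSubgroup (Cofree ρ ↥(padicCoeffField (Set.range ι))) ϖ y = 0} : Set _).Finite → ∃ (P : Type) (_ : AddCommGroup P) (_ : Module ↥(padicCoeffIntegers (Set.range ι)) P) (H : Type) (_ : AddCommGroup H) (_ : Module ↥(padicCoeffIntegers (Set.range ι)) H) (H2 : Type) (_ : AddCommGroup H2) (_ : Module ↥(padicCoeffIntegers (Set.range ι)) H2) (pair : P →ₗ[↥(padicCoeffIntegers (Set.range ι))] CharacterModule ↥Sg) (locd : H →ₗ[↥(padicCoeffIntegers (Set.range ι))] P) (Z : Submodule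 ↥(padicCoeffIntegers (Set.range ι)) H) (Sel₀ : Submodule ↥(padicCoeffIntegers (Set.range ι)) ↥Sg) (e : ℕ), (∀ z ∈ Z, pair (locd z) = 0) ∧ (∀ s ∈ Sel₀, ∀ z : P, pair z s = 0) ∧ (∀ z : P, pair z = 0 → ∃ a : ↥(padicCoeffIntegers (Set.range ι)), a ≠ 0 ∧ ∃ x : H, a • z = locd x) ∧ Module.Finite (FractionRing ↥(padicCoeffIntegers (Set.range ι))) (TensorProduct ↥(padicCoeffIntegers (Set.range ι)) (FractionRing ↥(padicCoeffIntegers (Set.range ι))) (H ⧸ Z)) ∧ Module.Finite (FractionRing ↥(padicCoeffIntegers (Set.range ι))) (TensorProduct ↥(padicCoeffIntegers (Set.range ι)) (FractionRing ↥(padicCoeffIntegers (Set.range ι))) (P ⧸ Z.map locd)) ∧ d + (∑ v ∈ S₀, 2 ^ padicValNat 2 ((natGenerator v ^ 2 - 1) / 8) * (if natGenerator v ∣ M then (if ‖embCoeff g ι (natGenerator v) - 1‖ < 1 then 1 else 0) else (if ‖embCoeff g ι (natGenerator v)‖ < 1 then 2 else 0))) + e ≤ Module.finrank (FractionRing ↥(padicCoeffIntegers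 (Set.range ι))) (TensorProduct ↥(padicCoeffIntegers (Set.range ι)) (FractionRing ↥(padicCoeffIntegers (Set.range ι))) (P ⧸ Z.map locd)) ∧ Module.finrank (FractionRing ↥(padicCoeffIntegers (Set.range ι))) (TensorProduct ↥(padicCoeffIntegers (Set.range ι)) (FractionRing ↥(padicCoeffIntegers (Set.range ι))) (H ⧸ Z)) ≤ Module.finrank (FractionRing ↥(padicCoeffIntegers (Set.range ι))) (TensorProduct ↥(padicCoeffIntegers (Set.range ι)) (FractionRing ↥(padicCoeffIntegers (Set.range ι))) (H2)) + e ∧ Module.finrank (FractionRing ↥(padicCoeffIntegers (Set.range ι))) (TensorProduct ↥(padicCoeffIntegers (Set.range ι)) (FractionRing ↥(padicCoeffIntegers (Set.range ι))) (H2)) ≤ Module.finrank (FractionRing ↥(padicCoeffIntegers (Set.range ι))) (TensorProduct ↥(padicCoeffIntegers (Set.range ι)) (FractionRing ↥(padicCoeffIntegers (Set.range ι))) (CharacterModule ↥Sel₀))) :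
    Summit.BirchSwinnertonDyer.BirchSwinnertonDyer.Theses.ResidualThetaTransportAtTwo.ResidualSignedLambdaLowerCMAtTwo :=
  cmLambdaLower_of_dualityData_onePair hdata

end Summit.BirchSwinnertonDyer.BirchSwinnertonDyer.Cruxes.ResidualThetaCountLowerPureAtTwo.ScritG9

end
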